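import Literature.NumberTheory.EllipticCurves.HeckeTnGamma0
import HarnessLib

/-!
# The trace of `T_n`, `(n, N) = 1`, on `S_k(Γ₀(N))` is real

For `n ≥ 1` prime to `N` the operator `T_n = heckeTnGamma0 N k n` acts on each simultaneous
eigenspace `V_χ` of the semisimple commuting family `(T_p)_{p ∤ N}` (`isSemisimpleFamily_heckeTnGamma0`,
Petersson self-adjointness, Diamond–Shurman Thm. 5.5.3–5.5.4) by a scalar which is a polynomial with
real coefficients in the real eigenvalues `χ(p)` (`T_p` self-adjoint ⇒ `conj χ(p) = χ(p)`; the Hecke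
recursions `T_{p^{a+2}} = T_p T_{p^{a+1}} − p^{k−1} T_{p^a}`, `T_{mn} = T_m T_n`), hence
`tr T_n = Σ_χ dim V_χ · λ_χ(n)` is real.  This is the (standard) input "`tr T_n ∈ ℝ`" used to pass
from the trace of the transpose of `T_n` on the real period space `Hom_ℝ(S₂, ℂ)` back to the
complex trace in the Popa–Zagier proof of the Eichler–Selberg trace formula on modular symbols.

## References
* [DiamondShurman2005] F. Diamond, J. Shurman, *A First Course in Modular Forms*, GTM 228,
  Thm. 5.5.3 (self-adjointness of `T_p`, `p ∤ N`), §5.3 (Hecke recursions).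
-/

noncomputable section

open scoped ComplexConjugate

namespace Literature.NumberTheory.EllipticCurves.ModularForms

open Literature.NumberTheory.Automorphic CongruenceSubgroup
open Literature.NumberTheory.Automorphic.HeckeTraceFormulaGL2Level

variable (N : ℕ) [NeZero N] (k : ℤ)

/-- **`T_n`, `(n, N) = 1`, acts on each simultaneous `T_p`-eigenspace `V_χ` of `S_k(Γ₀(N))` by a
real scalar**: there is `e ∈ ℂ` with `conj e = e` and `T_n v = e v` for all `v ∈ V_χ`
(induction on `n` along the Hecke recursions; the eigenvalues `χ(p)` of the self-adjoint `T_p` are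
real, Diamond–Shurman Thm. 5.5.3). [cite: DiamondShurman2005, Thm. 5.5.3 and §5.3] -/
theorem exists_real_scalar_heckeTnGamma0_of_mem_eigenChar {n : ℕ} (hn : 0 < n) (hnN : n.Coprime N)
    (χ : PrimesNotDvd N → ℂ) :
    ∃ e : ℂ, conj e = e ∧ ∀ v ∈ eigenChar N (heckeTnGamma0 N k) χ, heckeTnGamma0 N k n v = e • v := by
  induction n using Nat.recOnPosPrimePosCoprime with
  | zero => exact absurd hn (lt_irrefl 0)
  | one => exact ⟨1, map_one _, fun v _ => by rw [heckeTnGamma0_one, one_smul]; rfl⟩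
  | prime_pow p a hp ha =>
    have hpN : ¬ p ∣ N := by
      intro h
      have h1 : p ∣ Nat.gcd (p ^ a) N := Nat.dvd_gcd (dvd_pow_self p ha.ne') h
      rw [hnN] at h1
      exact hp.one_lt.ne' (Nat.dvd_one.mp h1)
    haveI : NeZero p := ⟨hp.ne_zero⟩
    -- the eigenvalue `χ p` is real as soon as `V_χ ≠ 0`; in general pick a real scalar for `T_p`
    have hTp : ∃ e₁ : ℂ, conj e₁ = e₁ ∧
        ∀ v ∈ eigenChar N (heckeTnGamma0 N k) χ, heckeTnGamma0 N k p v = e₁ • v := by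
      by_cases hbot : ∀ v ∈ eigenChar N (heckeTnGamma0 N k) χ, v = 0
      · exact ⟨0, map_zero _, fun v hv => by rw [hbot v hv, map_zero, smul_zero]⟩
      · push Not at hbot
        obtain ⟨w, hw, hw0⟩ := hbot
        have hTw : heckeTnGamma0 N k p w = χ ⟨p, hp, hpN⟩ • w := (mem_eigenChar_iff.mp hw) ⟨p, hp, hpN⟩
        refine ⟨χ ⟨p, hp, hpN⟩, ?_, fun v hv => (mem_eigenChar_iff.mp hv) ⟨p, hp, hpN⟩⟩
        rw [heckeTnGamma0_prime N k p hp] at hTw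
        have hsa := heckeT_selfAdjoint_holds N k p hp hpN w w
        rw [hTw, peterssonProduct_smul_left, peterssonProduct_smul_right] at hsa
        have hff : peterssonProduct (Gamma0 N) k w w ≠ 0 := fun h =>
          hw0 (eq_zero_of_peterssonProduct_self_eq_zero k w h)
        exact mul_right_cancel₀ hff hsa
    obtain ⟨e₁, he₁, hTe₁⟩ := hTp
    -- two-step induction on the exponent
    have key : ∀ b : ℕ, ∃ e e' : ℂ, conj e = e ∧ conj e' = e' ∧
        (∀ v ∈ eigenChar N (heckeTnGamma0 N k) χ, heckeTnGamma0 N k (p ^ b) v = e • v) ∧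
        (∀ v ∈ eigenChar N (heckeTnGamma0 N k) χ, heckeTnGamma0 N k (p ^ (b + 1)) v = e' • v) := by
      intro b
      induction b with
      | zero =>
        exact ⟨1, e₁, map_one _, he₁, fun v _ => by rw [pow_zero, heckeTnGamma0_one, one_smul]; rfl,
          fun v hv => by rw [pow_one]; exact hTe₁ v hv⟩
      | succ b ih =>
        obtain ⟨e, e', he, he', hTe, hTe'⟩ := ih
        refine ⟨e', e' * e₁ - (p : ℂ) ^ (k - 1) * e, he', ?_, hTe', fun v hv => ?_⟩
        · rw [map_sub, map_mul, map_mul, he₁, he', he, map_zpow₀, Complex.conj_natCast]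
        · rw [show b + 1 + 1 = b + 2 from rfl, heckeTnGamma0_prime_pow N k hp hpN b,
            LinearMap.sub_apply, LinearMap.smul_apply, Module.End.mul_apply, hTe' v hv, map_smul,
            hTe₁ v hv, hTe v hv, smul_smul, smul_smul, sub_smul]
    obtain ⟨e, -, he, -, hTe, -⟩ := key a
    exact ⟨e, he, hTe⟩
  | coprime a b ha hb hab iha ihb =>
    have haN : a.Coprime N := Nat.Coprime.coprime_mul_right hnN
    have hbN : b.Coprime N := Nat.Coprime.coprime_mul_left hnN
    obtain ⟨ea, hea, hTa⟩ := iha (by omega) haN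
    obtain ⟨eb, heb, hTb⟩ := ihb (by omega) hbN
    refine ⟨eb * ea, by rw [map_mul, hea, heb], fun v hv => ?_⟩
    rw [heckeTnGamma0_mul_of_coprime N k (by omega) (by omega) hab, Module.End.mul_apply, hTb v hv,
      map_smul, hTa v hv, smul_smul]

/-- **The trace of `T_n`, `(n, N) = 1`, on `S_k(Γ₀(N))` is real**: `conj (tr T_n) = tr T_n`
(`tr T_n = Σ_χ dim V_χ · λ_χ(n)` over the simultaneous eigenspaces of the self-adjoint family
`(T_p)_{p ∤ N}`, with real `λ_χ(n)`). [cite: DiamondShurman2005, Thm. 5.5.3 and §5.3] -/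
theorem conj_trace_heckeTnGamma0 {n : ℕ} (hn : 0 < n) (hnN : n.Coprime N) :
    conj (LinearMap.trace ℂ _ (heckeTnGamma0 N k n)) = LinearMap.trace ℂ _ (heckeTnGamma0 N k n) := by
  classical
  haveI : FiniteDimensional ℂ (CuspForm (Gamma0 N) k) := finiteDimensional_cuspForm_gamma0 N k
  have hs := isSemisimpleFamily_heckeTnGamma0 N k
  choose e he hTe using fun χ => exists_real_scalar_heckeTnGamma0_of_mem_eigenChar N k hn hnN χ
  rw [hs.trace_eq_sum_finrank_eigenChar_mul (heckeTnGamma0 N k n) e hTe, map_sum]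
  refine Finset.sum_congr rfl fun χ _ => ?_
  rw [map_mul, Complex.conj_natCast, he]

/-- The imaginary part of `tr T_n`, `(n, N) = 1`, vanishes. [cite: DiamondShurman2005, Thm. 5.5.3 and §5.3] -/
theorem im_trace_heckeTnGamma0 {n : ℕ} (hn : 0 < n) (hnN : n.Coprime N) :
    (LinearMap.trace ℂ _ (heckeTnGamma0 N k n)).im = 0 :=
  Complex.conj_eq_iff_im.mp (conj_trace_heckeTnGamma0 N k hn hnN)

/-- `tr T_n = Re (tr T_n)` for `(n, N) = 1`. [cite: DiamondShurman2005, Thm. 5.5.3 and §5.3] -/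
theorem ofReal_re_trace_heckeTnGamma0 {n : ℕ} (hn : 0 < n) (hnN : n.Coprime N) :
    (((LinearMap.trace ℂ _ (heckeTnGamma0 N k n)).re : ℝ) : ℂ) = LinearMap.trace ℂ _ (heckeTnGamma0 N k n) :=
  Complex.conj_eq_iff_re.mp (conj_trace_heckeTnGamma0 N k hn hnN)

/-- The Eichler–Selberg left-hand side `cuspidalHeckeTrace N k 𝟙 n` is real for `(n, N) = 1`.
[cite: DiamondShurman2005, Thm. 5.5.3 and §5.3] -/
theorem ofReal_re_cuspidalHeckeTrace {n : ℕ} (hn : 0 < n) (hnN : n.Coprime N) :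
    (((cuspidalHeckeTrace N k 1 n).re : ℝ) : ℂ) = cuspidalHeckeTrace N k 1 n := by
  rw [← trace_heckeTnGamma0]; exact ofReal_re_trace_heckeTnGamma0 N k hn hnN

end Literature.NumberTheory.EllipticCurves.ModularForms

end
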